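import Mathlib.MeasureTheory.Integral.Bochner.Basic
import Mathlib.MeasureTheory.Function.SpecialFunctions.Basic
import Literature.MathematicalPhysics.QuantumFieldTheory.CurvatureGaussianField
import HarnessLib

/-!
# Stub `stub_steinReduction` (TS9) of line `Sketch` (crux `stmt-QuantumFields-8760`)

Route `EquipartitionCriticality` of `YangMills`, crux item `stmt-QuantumFields-8760`
(`Summit.QuantumFields.YangMills.Theses.EquipartitionCriticality.EquipartitionPinsProbe`), line
`Sketch`, stub `stub_steinReduction`.

Setting: `Ω := ZdPlaquette 4 → Fin D → ℝ` (the `ℝ^D`-valued `2`-cochains of `ℤ⁴`, product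
σ-algebra), `τ` a probability measure on `Ω` all of whose coordinates are square integrable. For a
finite plaquette set `S` and coefficients `h` write `L_{S,h}(Y) := ∑_{p ∈ S} ∑_a h p a · Y p a`,
and for an edge `e` write `dδ_e := plaquetteCurl (𝟙_{e})` (the curl of the indicator `1`-cochain
of `e`).

What is proved (`stub_steinReduction`): the *single-edge* trigonometric Stein identities
`∫ cos L_{S,h} · (∑_{p∈S} dδ_e p · Y p b) dτ = -(∑_{p∈S} dδ_e p · h p b) ∫ sin L_{S,h} dτ` (and the
`sin`/`cos` companion), assumed for all `S ⊇ plaquettesTouching {e}`, all `h`, `e`, `b`, imply the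
same identities for the curl `dα` of an arbitrary finitely supported `ℝ^D`-valued `1`-cochain `α`
(supported in a finite edge set `E`, with `dα` supported in `S`).

Proof (pure linear algebra plus linearity of the Bochner integral):
* `plaquetteCurl` is linear, so `dα_a = ∑_{e ∈ E} α e a · dδ_e`
  (`TangentSteinReduction.plaquetteCurl_eq_sum_indicator`), whence
  `∑_{p∈T} ∑_a dα_a p · g p a = ∑_{e∈E} ∑_a α e a · ∑_{p∈T} dδ_e p · g p a` for every finite `T`
  (`TangentSteinReduction.sum_curl_mul_eq`).
* Enlarge `S` to `S' := S ∪ ⋃_{e∈E} plaquettesTouching {e}` and cut `h` off outside `S`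
  (`h' := 𝟙_S h`): then `L_{S',h'} = L_{S,h}` and `∑_{p∈S'} dδ_e p · h' p b = ∑_{p∈S} dδ_e p · h p b`,
  so the hypothesis at `(S', h', e, b)` is the single-edge identity with `L_{S,h}` and the linear
  statistic `∑_{p∈S'} dδ_e p · Y p b`.
* Each `Y ↦ Y p a` is integrable (`|y| ≤ (1 + y²)/2` on a probability space), so each
  `cos L_{S,h} · ∑_{p∈S'} dδ_e p · Y p b` is integrable (bounded measurable times integrable) and the
  integral of the finite linear combination is the linear combination of the integrals
  (`TangentSteinReduction.integral_mul_sum_sum`); re-collecting the sums gives the claim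
  (`TangentSteinReduction.stein_of_singleEdge`).
-/

noncomputable section

open MeasureTheory
open Literature.MathematicalPhysics.QuantumFieldTheory Literature.MathematicalPhysics.QuantumLattice

namespace Summit.QuantumFields.YangMills.Theorems.EquipartitionPinsProbe

namespace TangentSteinReduction

/-- **Linearity of the lattice curl against indicator `1`-cochains.** If the `1`-cochain `α`
vanishes outside the finite edge set `E`, then `dα = ∑_{e ∈ E} α e · dδ_e`, where `δ_e` is the
indicator `1`-cochain of the edge `e`. -/
theorem plaquetteCurl_eq_sum_indicator {d : ℕ} (E : Finset (ZdEdge d)) (α : ZdEdge d → ℝ)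
    (hα : ∀ e, e ∉ E → α e = 0) (p : ZdPlaquette d) :
    plaquetteCurl α p =
      ∑ e ∈ E, α e * plaquetteCurl (fun e' => if e' = e then (1 : ℝ) else 0) p := by
  classical
  simp only [plaquetteCurl, Finset.mul_sum]
  rw [Finset.sum_comm]
  refine Finset.sum_congr rfl fun i _ => ?_
  have h1 : ∀ e ∈ E, α e * (plaquetteBoundarySign i * if plaquetteBoundary p i = e then 1 else 0) =
      if plaquetteBoundary p i = e then plaquetteBoundarySign i * α e else 0 := by
    intro e _
    split_ifs <;> ring
  rw [Finset.sum_congr rfl h1, Finset.sum_ite_eq]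
  split_ifs with h
  · rfl
  · rw [hα _ h, mul_zero]

/-- **Re-indexing a curl-weighted sum by edges.** For `α : ZdEdge d → Fin D → ℝ` vanishing
outside `E`, every finite plaquette set `T` and every `g`,
`∑_{p∈T} ∑_a (dα_a)(p) g p a = ∑_{e∈E} ∑_a α e a ∑_{p∈T} (dδ_e)(p) g p a`. -/
theorem sum_curl_mul_eq {d D : ℕ} (E : Finset (ZdEdge d)) (α : ZdEdge d → Fin D → ℝ)
    (hα : ∀ e, e ∉ E → α e = 0) (T : Finset (ZdPlaquette d)) (g : ZdPlaquette d → Fin D → ℝ) :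
    ∑ p ∈ T, ∑ a : Fin D, plaquetteCurl (fun e => α e a) p * g p a =
      ∑ e ∈ E, ∑ a : Fin D, α e a *
        ∑ p ∈ T, plaquetteCurl (fun e' => if e' = e then (1 : ℝ) else 0) p * g p a := by
  calc ∑ p ∈ T, ∑ a : Fin D, plaquetteCurl (fun e => α e a) p * g p a
      = ∑ p ∈ T, ∑ a : Fin D, ∑ e ∈ E,
          α e a * (plaquetteCurl (fun e' => if e' = e then (1 : ℝ) else 0) p * g p a) := by
        refine Finset.sum_congr rfl fun p _ => Finset.sum_congr rfl fun a _ => ?_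
        rw [plaquetteCurl_eq_sum_indicator E (fun e => α e a) (fun e he => by rw [hα e he]; rfl) p,
          Finset.sum_mul]
        exact Finset.sum_congr rfl fun e _ => mul_assoc _ _ _
    _ = ∑ a : Fin D, ∑ p ∈ T, ∑ e ∈ E,
          α e a * (plaquetteCurl (fun e' => if e' = e then (1 : ℝ) else 0) p * g p a) :=
        Finset.sum_comm
    _ = ∑ a : Fin D, ∑ e ∈ E, ∑ p ∈ T,
          α e a * (plaquetteCurl (fun e' => if e' = e then (1 : ℝ) else 0) p * g p a) :=
        Finset.sum_congr rfl fun a _ => Finset.sum_comm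
    _ = ∑ e ∈ E, ∑ a : Fin D, ∑ p ∈ T,
          α e a * (plaquetteCurl (fun e' => if e' = e then (1 : ℝ) else 0) p * g p a) :=
        Finset.sum_comm
    _ = _ := by simp only [Finset.mul_sum]

/-- **Linearity of the integral against a weighted double sum.** If each `g · ℓ i k` is
integrable, then `∫ g · (∑_{i∈s} ∑_{k∈t} c i k · ℓ i k) dμ = ∑_{i∈s} ∑_{k∈t} c i k ∫ g · ℓ i k dμ`. -/
theorem integral_mul_sum_sum {Ω ι κ : Type*} [MeasurableSpace Ω] {μ : Measure Ω} (s : Finset ι)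
    (t : Finset κ) (c : ι → κ → ℝ) (g : Ω → ℝ) (ℓ : ι → κ → Ω → ℝ)
    (hint : ∀ i ∈ s, ∀ k ∈ t, Integrable (fun x => g x * ℓ i k x) μ) :
    ∫ x, g x * (∑ i ∈ s, ∑ k ∈ t, c i k * ℓ i k x) ∂μ =
      ∑ i ∈ s, ∑ k ∈ t, c i k * ∫ x, g x * ℓ i k x ∂μ := by
  have h1 : ∀ x, g x * (∑ i ∈ s, ∑ k ∈ t, c i k * ℓ i k x) =
      ∑ i ∈ s, ∑ k ∈ t, c i k * (g x * ℓ i k x) := by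
    intro x
    rw [Finset.mul_sum]
    refine Finset.sum_congr rfl fun i _ => ?_
    rw [Finset.mul_sum]
    exact Finset.sum_congr rfl fun k _ => by ring
  simp_rw [h1]
  rw [integral_finsetSum _ (fun i hi =>
    integrable_finsetSum _ (fun k hk => (hint i hi k hk).const_mul (c i k)))]
  refine Finset.sum_congr rfl fun i hi => ?_
  rw [integral_finsetSum _ (fun k hk => (hint i hi k hk).const_mul (c i k))]
  exact Finset.sum_congr rfl fun k _ => integral_const_mul _ _

/-- On a finite measure space a measurable real function with integrable square is integrable
(`|y| ≤ (1 + y²) / 2`). -/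
theorem integrable_of_integrable_sq {Ω : Type*} [MeasurableSpace Ω] {μ : Measure Ω}
    [IsFiniteMeasure μ] {f : Ω → ℝ} (hf : Measurable f)
    (hsq : Integrable (fun x => f x ^ 2) μ) : Integrable f μ := by
  refine Integrable.mono' (((integrable_const (1 : ℝ)).add hsq).div_const 2)
    hf.aestronglyMeasurable (Filter.Eventually.of_forall fun x => ?_)
  simp only [Pi.add_apply, Real.norm_eq_abs]
  nlinarith [sq_abs (f x), sq_nonneg (|f x| - 1), abs_nonneg (f x)]

/-- **The reduction, abstract form.** Let `τ` be a probability measure on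
`Ω = (ZdPlaquette 4 → Fin D → ℝ)` with square-integrable coordinates, `g : Ω → ℝ` measurable with
`|g| ≤ 1`, `K : ℝ`, `S ⊆ S'` finite plaquette sets, `E` a finite edge set, `α` an `ℝ^D`-valued
`1`-cochain vanishing outside `E` whose curls `dα_a` vanish outside `S`. If for every `e ∈ E` and
`b` the single-edge identity `∫ g · (∑_{p∈S'} dδ_e p · Y p b) dτ = (∑_{p∈S} dδ_e p · h p b) · K`
holds, then `∫ g · (∑_{p∈S} ∑_a dα_a p · Y p a) dτ = (∑_{p∈S} ∑_a dα_a p · h p a) · K`. -/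
theorem stein_of_singleEdge {D : ℕ} (τ : Measure (ZdPlaquette 4 → Fin D → ℝ))
    [IsProbabilityMeasure τ]
    (hsq : ∀ (p : ZdPlaquette 4) (a : Fin D), Integrable (fun Y => (Y p a) ^ 2) τ)
    (g : (ZdPlaquette 4 → Fin D → ℝ) → ℝ) (hgm : Measurable g) (hgb : ∀ Y, |g Y| ≤ 1) (K : ℝ)
    (S S' : Finset (ZdPlaquette 4)) (hSS' : S ⊆ S') (E : Finset (ZdEdge 4))
    (h : ZdPlaquette 4 → Fin D → ℝ) (α : ZdEdge 4 → Fin D → ℝ) (hαE : ∀ e, e ∉ E → α e = 0)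
    (hαS : ∀ p, p ∉ S → ∀ a : Fin D, plaquetteCurl (fun e => α e a) p = 0)
    (hid : ∀ e ∈ E, ∀ b : Fin D,
      ∫ Y, g Y * (∑ p ∈ S', plaquetteCurl (fun e' => if e' = e then (1 : ℝ) else 0) p * Y p b) ∂τ =
        (∑ p ∈ S, plaquetteCurl (fun e' => if e' = e then (1 : ℝ) else 0) p * h p b) * K) :
    ∫ Y, g Y * (∑ p ∈ S, ∑ a : Fin D, plaquetteCurl (fun e => α e a) p * Y p a) ∂τ =
      (∑ p ∈ S, ∑ a : Fin D, plaquetteCurl (fun e => α e a) p * h p a) * K := by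
  -- coordinates are measurable and integrable
  have hmeas : ∀ (p : ZdPlaquette 4) (a : Fin D),
      Measurable (fun Y : ZdPlaquette 4 → Fin D → ℝ => Y p a) := fun p a =>
    (measurable_pi_apply a).comp (measurable_pi_apply p)
  have hint1 : ∀ (p : ZdPlaquette 4) (a : Fin D),
      Integrable (fun Y : ZdPlaquette 4 → Fin D → ℝ => Y p a) τ := fun p a =>
    integrable_of_integrable_sq (hmeas p a) (hsq p a)
  -- hence each single-edge integrand is integrable
  have hint : ∀ e ∈ E, ∀ b ∈ (Finset.univ : Finset (Fin D)), Integrable (fun Y => g Y *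
      (∑ p ∈ S', plaquetteCurl (fun e' => if e' = e then (1 : ℝ) else 0) p * Y p b)) τ := by
    intro e _ b _
    refine Integrable.bdd_mul (c := 1) ?_ hgm.aestronglyMeasurable
      (Filter.Eventually.of_forall fun Y => ?_)
    · exact integrable_finsetSum _ fun p _ => (hint1 p b).const_mul _
    · rw [Real.norm_eq_abs]
      exact hgb Y
  -- the statistic of `dα` over `S` equals that over `S'`, re-indexed by edges
  have hℓ : ∀ Y : ZdPlaquette 4 → Fin D → ℝ,
      ∑ p ∈ S, ∑ a : Fin D, plaquetteCurl (fun e => α e a) p * Y p a =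
        ∑ e ∈ E, ∑ a : Fin D, α e a *
          ∑ p ∈ S', plaquetteCurl (fun e' => if e' = e then (1 : ℝ) else 0) p * Y p a := by
    intro Y
    rw [Finset.sum_subset hSS' (fun p _ hpS => ?_)]
    · exact sum_curl_mul_eq E α hαE S' Y
    · exact Finset.sum_eq_zero fun a _ => by rw [hαS p hpS a, zero_mul]
  calc ∫ Y, g Y * (∑ p ∈ S, ∑ a : Fin D, plaquetteCurl (fun e => α e a) p * Y p a) ∂τ
      = ∫ Y, g Y * (∑ e ∈ E, ∑ a : Fin D, α e a *
          ∑ p ∈ S', plaquetteCurl (fun e' => if e' = e then (1 : ℝ) else 0) p * Y p a) ∂τ := by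
        simp_rw [hℓ]
    _ = ∑ e ∈ E, ∑ a : Fin D, α e a * ∫ Y, g Y *
          (∑ p ∈ S', plaquetteCurl (fun e' => if e' = e then (1 : ℝ) else 0) p * Y p a) ∂τ :=
        integral_mul_sum_sum E Finset.univ α g _ hint
    _ = ∑ e ∈ E, ∑ a : Fin D, α e a *
          ((∑ p ∈ S, plaquetteCurl (fun e' => if e' = e then (1 : ℝ) else 0) p * h p a) * K) :=
        Finset.sum_congr rfl fun e he => Finset.sum_congr rfl fun a _ => by rw [hid e he a]
    _ = (∑ e ∈ E, ∑ a : Fin D, α e a *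
          ∑ p ∈ S, plaquetteCurl (fun e' => if e' = e then (1 : ℝ) else 0) p * h p a) * K := by
        simp only [Finset.sum_mul, mul_assoc]
    _ = _ := by rw [← sum_curl_mul_eq E α hαE S h]

end TangentSteinReduction

/-- STUB `stub_steinReduction` (TS9) — **from single-edge to general trigonometric Stein
identities of the tangent law.** Let `τ` be a probability measure on the `ℝ^D`-valued `2`-cochains
`Ω = (ZdPlaquette 4 → Fin D → ℝ)` of `ℤ⁴` with square-integrable coordinates, and suppose the
single-edge identities
`∫ cos L_{S,h} · (∑_{p∈S} dδ_e p · Y p b) dτ = -(∑_{p∈S} dδ_e p · h p b) ∫ sin L_{S,h} dτ`,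
`∫ sin L_{S,h} · (∑_{p∈S} dδ_e p · Y p b) dτ = (∑_{p∈S} dδ_e p · h p b) ∫ cos L_{S,h} dτ` hold for all
finite `S ⊇ plaquettesTouching {e}`, all `h`, `e`, `b` (`L_{S,h}(Y) = ∑_{p∈S} ∑_a h p a · Y p a`,
`dδ_e = plaquetteCurl 𝟙_{e}`). Then the same two identities hold with `dδ_e ⊗ δ_b` replaced by the
curl `dα` of any `1`-cochain `α` supported in a finite edge set `E` with `dα` supported in `S`.
Proof: linearity of `plaquetteCurl` and of the integral, after enlarging `S` to
`S ∪ ⋃_{e∈E} plaquettesTouching {e}` and cutting `h` off outside `S`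
(`TangentSteinReduction.stein_of_singleEdge`). -/
theorem stub_steinReduction :
    ∀ (D : ℕ) (τ : MeasureTheory.Measure (Literature.MathematicalPhysics.QuantumLattice.ZdPlaquette 4 → Fin D → ℝ)),
      MeasureTheory.IsProbabilityMeasure τ →
      (∀ (p : Literature.MathematicalPhysics.QuantumLattice.ZdPlaquette 4) (a : Fin D), MeasureTheory.Integrable (fun Y => (Y p a) ^ 2) τ) →
      (∀ (S : Finset (Literature.MathematicalPhysics.QuantumLattice.ZdPlaquette 4)) (h : Literature.MathematicalPhysics.QuantumLattice.ZdPlaquette 4 → Fin D → ℝ)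
          (e : Literature.MathematicalPhysics.QuantumLattice.ZdEdge 4) (b : Fin D),
        Literature.MathematicalPhysics.QuantumLattice.plaquettesTouching {e} ⊆ S →
        (∫ Y, Real.cos (∑ p ∈ S, ∑ a : Fin D, h p a * Y p a) *
              (∑ p ∈ S, Literature.MathematicalPhysics.QuantumFieldTheory.plaquetteCurl (fun e' => if e' = e then (1 : ℝ) else 0) p * Y p b) ∂τ =
            -(∑ p ∈ S, Literature.MathematicalPhysics.QuantumFieldTheory.plaquetteCurl (fun e' => if e' = e then (1 : ℝ) else 0) p * h p b) *
              ∫ Y, Real.sin (∑ p ∈ S, ∑ a : Fin D, h p a * Y p a) ∂τ) ∧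
        (∫ Y, Real.sin (∑ p ∈ S, ∑ a : Fin D, h p a * Y p a) *
              (∑ p ∈ S, Literature.MathematicalPhysics.QuantumFieldTheory.plaquetteCurl (fun e' => if e' = e then (1 : ℝ) else 0) p * Y p b) ∂τ =
            (∑ p ∈ S, Literature.MathematicalPhysics.QuantumFieldTheory.plaquetteCurl (fun e' => if e' = e then (1 : ℝ) else 0) p * h p b) *
              ∫ Y, Real.cos (∑ p ∈ S, ∑ a : Fin D, h p a * Y p a) ∂τ)) →
      ∀ (S : Finset (Literature.MathematicalPhysics.QuantumLattice.ZdPlaquette 4)) (E : Finset (Literature.MathematicalPhysics.QuantumLattice.ZdEdge 4))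
        (h : Literature.MathematicalPhysics.QuantumLattice.ZdPlaquette 4 → Fin D → ℝ) (α : Literature.MathematicalPhysics.QuantumLattice.ZdEdge 4 → Fin D → ℝ),
        (∀ e, e ∉ E → α e = 0) →
        (∀ p, p ∉ S → ∀ a : Fin D, Literature.MathematicalPhysics.QuantumFieldTheory.plaquetteCurl (fun e => α e a) p = 0) →
        (∫ Y, Real.cos (∑ p ∈ S, ∑ a : Fin D, h p a * Y p a) *
              (∑ p ∈ S, ∑ a : Fin D, Literature.MathematicalPhysics.QuantumFieldTheory.plaquetteCurl (fun e => α e a) p * Y p a) ∂τ =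
            -(∑ p ∈ S, ∑ a : Fin D, Literature.MathematicalPhysics.QuantumFieldTheory.plaquetteCurl (fun e => α e a) p * h p a) *
              ∫ Y, Real.sin (∑ p ∈ S, ∑ a : Fin D, h p a * Y p a) ∂τ) ∧
        (∫ Y, Real.sin (∑ p ∈ S, ∑ a : Fin D, h p a * Y p a) *
              (∑ p ∈ S, ∑ a : Fin D, Literature.MathematicalPhysics.QuantumFieldTheory.plaquetteCurl (fun e => α e a) p * Y p a) ∂τ =
            (∑ p ∈ S, ∑ a : Fin D, Literature.MathematicalPhysics.QuantumFieldTheory.plaquetteCurl (fun e => α e a) p * h p a) *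
              ∫ Y, Real.cos (∑ p ∈ S, ∑ a : Fin D, h p a * Y p a) ∂τ) := by
  intro D τ hτ hsq hedge S E h α hαE hαS
  classical
  haveI : IsProbabilityMeasure τ := hτ
  -- enlarge `S` and cut `h` off outside `S`
  obtain ⟨S', hSS', hES'⟩ : ∃ S' : Finset (ZdPlaquette 4),
      S ⊆ S' ∧ ∀ e ∈ E, plaquettesTouching {e} ⊆ S' :=
    ⟨S ∪ E.biUnion fun e => plaquettesTouching {e}, Finset.subset_union_left, fun e he =>
      (Finset.subset_biUnion_of_mem (fun e => plaquettesTouching {e}) he).trans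
        Finset.subset_union_right⟩
  obtain ⟨h', hh'S, hh'nS⟩ : ∃ h' : ZdPlaquette 4 → Fin D → ℝ,
      (∀ p ∈ S, ∀ a, h' p a = h p a) ∧ (∀ p, p ∉ S → ∀ a, h' p a = 0) :=
    ⟨fun p a => if p ∈ S then h p a else 0, fun p hp a => if_pos hp, fun p hp a => if_neg hp⟩
  have hL : ∀ Y : ZdPlaquette 4 → Fin D → ℝ,
      ∑ p ∈ S', ∑ a : Fin D, h' p a * Y p a = ∑ p ∈ S, ∑ a : Fin D, h p a * Y p a := by
    intro Y
    rw [← Finset.sum_subset hSS' (fun p _ hpS => ?_)]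
    · exact Finset.sum_congr rfl fun p hp => Finset.sum_congr rfl fun a _ => by rw [hh'S p hp a]
    · exact Finset.sum_eq_zero fun a _ => by rw [hh'nS p hpS a, zero_mul]
  have hR : ∀ (e : ZdEdge 4) (b : Fin D),
      ∑ p ∈ S', plaquetteCurl (fun e' => if e' = e then (1 : ℝ) else 0) p * h' p b =
        ∑ p ∈ S, plaquetteCurl (fun e' => if e' = e then (1 : ℝ) else 0) p * h p b := by
    intro e b
    rw [← Finset.sum_subset hSS' (fun p _ hpS => ?_)]
    · exact Finset.sum_congr rfl fun p hp => by rw [hh'S p hp b]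
    · rw [hh'nS p hpS b, mul_zero]
  -- the single-edge identities at `(S', h')`, rewritten in terms of `(S, h)`
  have hedge' : ∀ e ∈ E, ∀ b : Fin D,
      (∫ Y, Real.cos (∑ p ∈ S, ∑ a : Fin D, h p a * Y p a) *
            (∑ p ∈ S', plaquetteCurl (fun e' => if e' = e then (1 : ℝ) else 0) p * Y p b) ∂τ =
          -(∑ p ∈ S, plaquetteCurl (fun e' => if e' = e then (1 : ℝ) else 0) p * h p b) *
            ∫ Y, Real.sin (∑ p ∈ S, ∑ a : Fin D, h p a * Y p a) ∂τ) ∧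
      (∫ Y, Real.sin (∑ p ∈ S, ∑ a : Fin D, h p a * Y p a) *
            (∑ p ∈ S', plaquetteCurl (fun e' => if e' = e then (1 : ℝ) else 0) p * Y p b) ∂τ =
          (∑ p ∈ S, plaquetteCurl (fun e' => if e' = e then (1 : ℝ) else 0) p * h p b) *
            ∫ Y, Real.cos (∑ p ∈ S, ∑ a : Fin D, h p a * Y p a) ∂τ) := by
    intro e he b
    have key := hedge S' h' e b (hES' e he)
    simp only [hL, hR] at key
    exact key
  -- measurability of the phase `L_{S,h}`
  have hmeas : ∀ (p : ZdPlaquette 4) (a : Fin D),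
      Measurable (fun Y : ZdPlaquette 4 → Fin D → ℝ => Y p a) := fun p a =>
    (measurable_pi_apply a).comp (measurable_pi_apply p)
  have hLm : Measurable fun Y : ZdPlaquette 4 → Fin D → ℝ => ∑ p ∈ S, ∑ a : Fin D, h p a * Y p a :=
    Finset.measurable_sum S fun p _ => Finset.measurable_sum Finset.univ fun a _ =>
      (hmeas p a).const_mul (h p a)
  refine ⟨?_, ?_⟩
  · have h1 := TangentSteinReduction.stein_of_singleEdge τ hsq
      (fun Y => Real.cos (∑ p ∈ S, ∑ a : Fin D, h p a * Y p a)) hLm.cos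
      (fun Y => Real.abs_cos_le_one _) (-∫ Y, Real.sin (∑ p ∈ S, ∑ a : Fin D, h p a * Y p a) ∂τ)
      S S' hSS' E h α hαE hαS (fun e he b => by rw [(hedge' e he b).1]; ring)
    rw [h1]
    ring
  · exact TangentSteinReduction.stein_of_singleEdge τ hsq
      (fun Y => Real.sin (∑ p ∈ S, ∑ a : Fin D, h p a * Y p a)) hLm.sin
      (fun Y => Real.abs_sin_le_one _) (∫ Y, Real.cos (∑ p ∈ S, ∑ a : Fin D, h p a * Y p a) ∂τ)
      S S' hSS' E h α hαE hαS (fun e he b => (hedge' e he b).2)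

end Summit.QuantumFields.YangMills.Theorems.EquipartitionPinsProbe

end
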